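import Literature.NumberTheory.GaloisRepresentations.LabelledWeightsBlockSum
import Literature.NumberTheory.GaloisRepresentations.FramedRepBlockSum
import HarnessLib

/-!
# Labelled Hodge–Tate weights of a block sum `ρ₁ ⊞ ρ₂` of framed representations

Topic `NumberTheory/GaloisRepresentations`; theorems only (no definition, no named fact).

Binary companion of `LabelledWeightsBlockSum` for the tree's block-sum normal form
`FramedRep.blockSum` (`(ρ₁ ⊞ ρ₂)(g) = diag(ρ₁ g, ρ₂ g)` on `Fin (m + n)` along `finSumFinEquiv`,
file `FramedRepBlockSum`): for every period-ring datum `𝔅` over `P`, every label `τ : F → E`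
and framed `ρ₁ : Γ →ₜ* GL_m(E)`, `ρ₂ : Γ →ₜ* GL_n(E)` whose label components `D_τ(ρᵢ)` are
finite-dimensional,

  `HT_τ(ρ₁ ⊞ ρ₂) = HT_τ(ρ₁) + HT_τ(ρ₂)`   (multiset sum; `labelledHodgeTateWeights_blockSum`),

from the binary-product form `HT_τ(ρ₁ × ρ₂) = HT_τ(ρ₁) + HT_τ(ρ₂)` for a representation acting
componentwise on `V₁ × V₂` (`labelledHodgeTateWeights_prod`, with
`dim Fil^i D_τ(ρ₁ × ρ₂) = dim Fil^i D_τ(ρ₁) + dim Fil^i D_τ(ρ₂)`, `finrank_labelFilD_prod`), the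
product representation being supplied by `ContinuousRep.exists_prod`, and transport along the
`E`-linear `Γ`-isomorphism `E^m × E^n ≃ E^{m+n}` (`labelledHodgeTateWeights_eq_of_equiv`).

Sources: Fontaine, Astérisque 223, Exp. III §1.5, Prop. 1.5.2 (`D_B(V₁ ⊕ V₂) = D_B(V₁) ⊕ D_B(V₂)`
with its filtration, §1.5.4); Patrikis, *Variations on a theorem of Tate*, §2.3.1; Serre,
*Linear representations of finite groups*, §1.3 (b) (direct sum in the concatenated basis).

## References

* [FontaineAsterisque223III] J.-M. Fontaine, *Représentations p-adiques semi-stables*,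
  Astérisque 223 (1994), Exp. III §1.5, Prop. 1.5.2.
* [Patrikis2019] S. Patrikis, *Variations on a theorem of Tate*, Mem. AMS 258 (2019), §2.3.1.
-/

noncomputable section

open scoped TensorProduct
open TensorProduct

namespace Literature.NumberTheory.GaloisRepresentations

universe u v v' w

/-! ### §1 The product representation -/

section Constructors

variable {G : Type*} [Group G] [TopologicalSpace G] {A : Type*} [CommRing A] [TopologicalSpace A]

/-- **Product representation** `ρ₁ × ρ₂` on `M₁ × M₂` (componentwise action, product topology).
[cite: FontaineAsterisque223III, Exp. III §1.5, Prop. 1.5.2] -/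
theorem ContinuousRep.exists_prod {M₁ M₂ : Type*} [AddCommGroup M₁] [Module A M₁]
    [TopologicalSpace M₁] [AddCommGroup M₂] [Module A M₂] [TopologicalSpace M₂]
    (ρ₁ : ContinuousRep G A M₁) (ρ₂ : ContinuousRep G A M₂) :
    ∃ ρ : ContinuousRep G A (M₁ × M₂), ∀ (g : G) (x : M₁ × M₂), ρ g x = (ρ₁ g x.1, ρ₂ g x.2) :=
  ⟨{ toRepresentation :=
      { toFun := fun g => (ρ₁ g : M₁ →ₗ[A] M₁).prodMap (ρ₂ g : M₂ →ₗ[A] M₂)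
        map_one' := by
          refine LinearMap.ext fun x => Prod.ext ?_ ?_
          · simp
          · simp
        map_mul' := fun g h => by
          refine LinearMap.ext fun x => Prod.ext ?_ ?_
          · simp
          · simp }
     continuous_smul :=
      (ρ₁.continuous_smul.comp (continuous_fst.prodMk (continuous_fst.comp continuous_snd))).prodMk
        (ρ₂.continuous_smul.comp (continuous_fst.prodMk (continuous_snd.comp continuous_snd))) },
    fun _ _ => rfl⟩

end Constructors

namespace PeriodRingData

-- Mathlib's own global value of `maxSynthPendingDepth` (nested instance problems on `M ⊗[P] 𝔅.B`).
set_option maxSynthPendingDepth 3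

/-! ### §2 Binary products -/

section Prod

variable {Γ : Type u} [Group Γ] [TopologicalSpace Γ] {P : Type v} {F : Type v'} [Field P]
  [Field F] [Algebra P F]
  {E : Type*} [Field E] [Algebra P E] [TopologicalSpace E]
  {M₁ : Type*} [AddCommGroup M₁] [Module E M₁] [Module P M₁] [IsScalarTower P E M₁]
  [TopologicalSpace M₁]
  {M₂ : Type*} [AddCommGroup M₂] [Module E M₂] [Module P M₂] [IsScalarTower P E M₂]
  [TopologicalSpace M₂]
  (𝔅 : PeriodRingData.{u, v, v', w} Γ P F) (ρ : ContinuousRep Γ E (M₁ × M₂))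
  (ρ₁ : ContinuousRep Γ E M₁) (ρ₂ : ContinuousRep Γ E M₂)

/-- **`dim_E Fil^i D_τ(ρ₁ × ρ₂) = dim_E Fil^i D_τ(ρ₁) + dim_E Fil^i D_τ(ρ₂)`** for a representation
acting componentwise on `V₁ × V₂`, the label components `D_τ(ρᵢ)` being finite-dimensional.
[cite: FontaineAsterisque223III, Exp. III §1.5.4 and Prop. 1.5.2] [cite: Patrikis2019, §2.3.1] -/
theorem finrank_labelFilD_prod (h : ∀ (σ : Γ) (x : M₁ × M₂), ρ σ x = (ρ₁ σ x.1, ρ₂ σ x.2))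
    (τ : F →+* E) (i : ℤ) (hfin₁ : FiniteDimensional E (𝔅.labelD ρ₁ τ))
    (hfin₂ : FiniteDimensional E (𝔅.labelD ρ₂ τ)) :
    Module.finrank E (𝔅.labelFilD ρ τ i) =
      Module.finrank E (𝔅.labelFilD ρ₁ τ i) + Module.finrank E (𝔅.labelFilD ρ₂ τ i) := by
  haveI : FiniteDimensional E (𝔅.labelFilD ρ₁ τ i) :=
    Submodule.finiteDimensional_of_le (𝔅.labelFilD_le ρ₁ τ i)
  haveI : FiniteDimensional E (𝔅.labelFilD ρ₂ τ i) :=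
    Submodule.finiteDimensional_of_le (𝔅.labelFilD_le ρ₂ τ i)
  let π₁ : (M₁ × M₂) ⊗[P] 𝔅.B →ₗ[E] M₁ ⊗[P] 𝔅.B :=
    AlgebraTensorModule.map (LinearMap.fst E M₁ M₂) LinearMap.id
  let π₂ : (M₁ × M₂) ⊗[P] 𝔅.B →ₗ[E] M₂ ⊗[P] 𝔅.B :=
    AlgebraTensorModule.map (LinearMap.snd E M₁ M₂) LinearMap.id
  let ι₁ : M₁ ⊗[P] 𝔅.B →ₗ[E] (M₁ × M₂) ⊗[P] 𝔅.B :=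
    AlgebraTensorModule.map (LinearMap.inl E M₁ M₂) LinearMap.id
  let ι₂ : M₂ ⊗[P] 𝔅.B →ₗ[E] (M₁ × M₂) ⊗[P] 𝔅.B :=
    AlgebraTensorModule.map (LinearMap.inr E M₁ M₂) LinearMap.id
  have hπ₁ : ∀ (σ : Γ) (x : M₁ × M₂),
      LinearMap.fst E M₁ M₂ (ρ σ x) = ρ₁ σ (LinearMap.fst E M₁ M₂ x) := fun σ x => by
    rw [h]; rfl
  have hπ₂ : ∀ (σ : Γ) (x : M₁ × M₂),
      LinearMap.snd E M₁ M₂ (ρ σ x) = ρ₂ σ (LinearMap.snd E M₁ M₂ x) := fun σ x => by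
    rw [h]; rfl
  have hι₁ : ∀ (σ : Γ) (m : M₁),
      LinearMap.inl E M₁ M₂ (ρ₁ σ m) = ρ σ (LinearMap.inl E M₁ M₂ m) := fun σ m => by
    rw [h]; simp
  have hι₂ : ∀ (σ : Γ) (m : M₂),
      LinearMap.inr E M₁ M₂ (ρ₂ σ m) = ρ σ (LinearMap.inr E M₁ M₂ m) := fun σ m => by
    rw [h]; simp
  -- `ι₁ π₁ + ι₂ π₂ = 1`
  have hsum : ∀ x : (M₁ × M₂) ⊗[P] 𝔅.B, ι₁ (π₁ x) + ι₂ (π₂ x) = x := fun x => by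
    induction x using TensorProduct.induction_on with
    | zero => simp only [map_zero, add_zero]
    | tmul m b =>
      simp only [π₁, π₂, ι₁, ι₂, AlgebraTensorModule.map_tmul, LinearMap.id_apply,
        LinearMap.fst_apply, LinearMap.snd_apply, LinearMap.inl_apply, LinearMap.inr_apply]
      rw [← TensorProduct.add_tmul, Prod.mk_add_mk, add_zero, zero_add]
    | add x y hx hy =>
      rw [map_add, map_add, map_add, map_add]
      calc ι₁ (π₁ x) + ι₁ (π₁ y) + (ι₂ (π₂ x) + ι₂ (π₂ y))
          = (ι₁ (π₁ x) + ι₂ (π₂ x)) + (ι₁ (π₁ y) + ι₂ (π₂ y)) := by abel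
        _ = x + y := by rw [hx, hy]
  -- the four compositions `πᵢ ιⱼ`
  have h₁₁ : ∀ y : M₁ ⊗[P] 𝔅.B, π₁ (ι₁ y) = y := fun y => by
    induction y using TensorProduct.induction_on with
    | zero => simp only [map_zero]
    | tmul m b => simp [π₁, ι₁]
    | add x y hx hy => simp only [map_add, hx, hy]
  have h₂₂ : ∀ y : M₂ ⊗[P] 𝔅.B, π₂ (ι₂ y) = y := fun y => by
    induction y using TensorProduct.induction_on with
    | zero => simp only [map_zero]
    | tmul m b => simp [π₂, ι₂]
    | add x y hx hy => simp only [map_add, hx, hy]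
  have h₁₂ : ∀ y : M₂ ⊗[P] 𝔅.B, π₁ (ι₂ y) = 0 := fun y => by
    induction y using TensorProduct.induction_on with
    | zero => simp only [map_zero]
    | tmul m b => simp [π₁, ι₂]
    | add x y hx hy => simp only [map_add, hx, hy, add_zero]
  have h₂₁ : ∀ y : M₁ ⊗[P] 𝔅.B, π₂ (ι₁ y) = 0 := fun y => by
    induction y using TensorProduct.induction_on with
    | zero => simp only [map_zero]
    | tmul m b => simp [π₂, ι₁]
    | add x y hx hy => simp only [map_add, hx, hy, add_zero]
  have hto₁ : ∀ x : 𝔅.labelFilD ρ τ i, π₁ x ∈ 𝔅.labelFilD ρ₁ τ i := fun x =>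
    𝔅.labelFilD_map_left ρ ρ₁ _ hπ₁ τ x.2
  have hto₂ : ∀ x : 𝔅.labelFilD ρ τ i, π₂ x ∈ 𝔅.labelFilD ρ₂ τ i := fun x =>
    𝔅.labelFilD_map_left ρ ρ₂ _ hπ₂ τ x.2
  have hinv : ∀ y : 𝔅.labelFilD ρ₁ τ i × 𝔅.labelFilD ρ₂ τ i,
      ι₁ (y.1 : M₁ ⊗[P] 𝔅.B) + ι₂ (y.2 : M₂ ⊗[P] 𝔅.B) ∈ 𝔅.labelFilD ρ τ i := fun y =>
    add_mem (𝔅.labelFilD_map_left ρ₁ ρ _ hι₁ τ y.1.2) (𝔅.labelFilD_map_left ρ₂ ρ _ hι₂ τ y.2.2)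
  let e : 𝔅.labelFilD ρ τ i ≃ₗ[E] 𝔅.labelFilD ρ₁ τ i × 𝔅.labelFilD ρ₂ τ i :=
    { toFun := fun x => (⟨π₁ x, hto₁ x⟩, ⟨π₂ x, hto₂ x⟩)
      map_add' := fun x y => by
        apply Prod.ext <;> apply Subtype.ext <;>
          simp only [Submodule.coe_add, map_add, Prod.fst_add, Prod.snd_add]
      map_smul' := fun c x => by
        apply Prod.ext <;> apply Subtype.ext <;>
          simp only [Submodule.coe_smul, map_smul, Prod.smul_fst, Prod.smul_snd, RingHom.id_apply]
      invFun := fun y => ⟨ι₁ (y.1 : M₁ ⊗[P] 𝔅.B) + ι₂ (y.2 : M₂ ⊗[P] 𝔅.B), hinv y⟩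
      left_inv := fun x => Subtype.ext (hsum x)
      right_inv := fun y => by
        apply Prod.ext <;> apply Subtype.ext
        · change π₁ (ι₁ (y.1 : M₁ ⊗[P] 𝔅.B) + ι₂ (y.2 : M₂ ⊗[P] 𝔅.B)) = y.1
          rw [map_add, h₁₁, h₁₂, add_zero]
        · change π₂ (ι₁ (y.1 : M₁ ⊗[P] 𝔅.B) + ι₂ (y.2 : M₂ ⊗[P] 𝔅.B)) = y.2
          rw [map_add, h₂₁, h₂₂, zero_add] }
  rw [e.finrank_eq, Module.finrank_prod]

/-- **Labelled Hodge–Tate weights are additive over binary products: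
`HT_τ(ρ₁ × ρ₂) = HT_τ(ρ₁) + HT_τ(ρ₂)`** (multiset sum) for a representation acting componentwise
on `V₁ × V₂`, the label components `D_τ(ρᵢ)` being finite-dimensional.
[cite: FontaineAsterisque223III, Exp. III §1.5.4 and Prop. 1.5.2] [cite: Patrikis2019, §2.3.1] -/
theorem labelledHodgeTateWeights_prod (h : ∀ (σ : Γ) (x : M₁ × M₂), ρ σ x = (ρ₁ σ x.1, ρ₂ σ x.2))
    (τ : F →+* E) (hfin₁ : FiniteDimensional E (𝔅.labelD ρ₁ τ))
    (hfin₂ : FiniteDimensional E (𝔅.labelD ρ₂ τ)) :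
    𝔅.labelledHodgeTateWeights ρ τ =
      𝔅.labelledHodgeTateWeights ρ₁ τ + 𝔅.labelledHodgeTateWeights ρ₂ τ := by
  haveI : ∀ j, FiniteDimensional E (𝔅.labelFilD ρ₁ τ j) := fun j =>
    Submodule.finiteDimensional_of_le (𝔅.labelFilD_le ρ₁ τ j)
  haveI : ∀ j, FiniteDimensional E (𝔅.labelFilD ρ₂ τ j) := fun j =>
    Submodule.finiteDimensional_of_le (𝔅.labelFilD_le ρ₂ τ j)
  have hd : (fun i => Module.finrank E (𝔅.labelFilD ρ τ i)) =
      (fun i => Module.finrank E (𝔅.labelFilD ρ₁ τ i)) +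
        fun i => Module.finrank E (𝔅.labelFilD ρ₂ τ i) := by
    funext i
    rw [Pi.add_apply]
    exact 𝔅.finrank_labelFilD_prod ρ ρ₁ ρ₂ h τ i hfin₁ hfin₂
  have hanti₁ : Antitone fun i => Module.finrank E (𝔅.labelFilD ρ₁ τ i) := fun a b hab =>
    Submodule.finrank_mono (𝔅.labelFilD_antitone ρ₁ τ hab)
  have hanti₂ : Antitone fun i => Module.finrank E (𝔅.labelFilD ρ₂ τ i) := fun a b hab =>
    Submodule.finrank_mono (𝔅.labelFilD_antitone ρ₂ τ hab)
  rw [labelledHodgeTateWeights_def, hd, labelledHodgeTateWeights_def, labelledHodgeTateWeights_def,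
    jumpMultiset_add hanti₁ hanti₂
      (jumps_finite_of_antitone_of_le hanti₁
        (fun j => Submodule.finrank_mono (𝔅.labelFilD_le ρ₁ τ j)))
      (jumps_finite_of_antitone_of_le hanti₂
        (fun j => Submodule.finrank_mono (𝔅.labelFilD_le ρ₂ τ j)))]

end Prod

/-! ### §3 Block sums of framed representations -/

section BlockSum

variable {Γ : Type u} [Group Γ] [TopologicalSpace Γ] {P : Type v} {F : Type v'} [Field P]
  [Field F] [Algebra P F]
  {E : Type*} [Field E] [Algebra P E] [TopologicalSpace E] [IsTopologicalRing E]
  (𝔅 : PeriodRingData.{u, v, v', w} Γ P F)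

/-- **`HT_τ(ρ₁ ⊞ ρ₂) = HT_τ(ρ₁) + HT_τ(ρ₂)`** (multiset sum) for the block sum
`FramedRep.blockSum` of framed `ρ₁ : Γ →ₜ* GL_m(E)`, `ρ₂ : Γ →ₜ* GL_n(E)` whose label components
`D_τ(ρᵢ)` are finite-dimensional, for every period-ring datum `𝔅` over `P` (intended `B_dR`) and
every label `τ : F → E`.
[cite: FontaineAsterisque223III, Exp. III §1.5, Prop. 1.5.2] [cite: Patrikis2019, §2.3.1] -/
theorem labelledHodgeTateWeights_blockSum {m n : ℕ} (ρ₁ : FramedRep Γ E m) (ρ₂ : FramedRep Γ E n)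
    (τ : F →+* E)
    (hfin₁ : FiniteDimensional E (𝔅.labelD (FramedRep.toContinuousRep ρ₁) τ))
    (hfin₂ : FiniteDimensional E (𝔅.labelD (FramedRep.toContinuousRep ρ₂) τ)) :
    𝔅.labelledHodgeTateWeights (FramedRep.toContinuousRep (ρ₁.blockSum ρ₂)) τ =
      𝔅.labelledHodgeTateWeights (FramedRep.toContinuousRep ρ₁) τ +
        𝔅.labelledHodgeTateWeights (FramedRep.toContinuousRep ρ₂) τ := by
  obtain ⟨ρπ, hρπ⟩ :=
    ContinuousRep.exists_prod (FramedRep.toContinuousRep ρ₁) (FramedRep.toContinuousRep ρ₂)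
  -- the `E`-linear isomorphism `E^m × E^n ≃ E^{m+n}` (concatenation along `finSumFinEquiv`)
  let Φ : ((Fin m → E) × (Fin n → E)) ≃ₗ[E] (Fin (m + n) → E) :=
    { toFun := fun x j => Sum.elim x.1 x.2 (finSumFinEquiv.symm j)
      invFun := fun v => (fun i => v (Fin.castAdd n i), fun i => v (Fin.natAdd m i))
      map_add' := fun x y => by
        funext j
        simp only [Prod.fst_add, Prod.snd_add, Pi.add_apply]
        cases finSumFinEquiv.symm j <;> simp
      map_smul' := fun c x => by
        funext j
        simp only [Prod.smul_fst, Prod.smul_snd, Pi.smul_apply, RingHom.id_apply]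
        cases finSumFinEquiv.symm j <;> simp
      left_inv := fun x => by
        apply Prod.ext
        · funext i
          simp
        · funext i
          simp
      right_inv := fun v => by
        funext j
        obtain ⟨s, rfl⟩ := finSumFinEquiv.surjective j
        rcases s with i | i
        · simp
        · simp }
  have hΦx : ∀ x : (Fin m → E) × (Fin n → E), (Φ x) ∘ finSumFinEquiv = Sum.elim x.1 x.2 := by
    intro x
    funext s
    change Sum.elim x.1 x.2 (finSumFinEquiv.symm (finSumFinEquiv s)) = _
    rw [Equiv.symm_apply_apply]
  have hΦ : ∀ (σ : Γ) (x : (Fin m → E) × (Fin n → E)),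
      Φ (ρπ σ x) = FramedRep.toContinuousRep (ρ₁.blockSum ρ₂) σ (Φ x) := by
    intro σ x
    rw [FramedRep.toContinuousRep_apply_apply, FramedRep.coe_blockSum_apply, blockSumRingHom_apply,
      Matrix.reindex_apply, Matrix.submatrix_mulVec_equiv, Equiv.symm_symm, hΦx,
      Matrix.fromBlocks_mulVec, Matrix.zero_mulVec, Matrix.zero_mulVec, add_zero, zero_add]
    funext j
    obtain ⟨s, rfl⟩ := finSumFinEquiv.surjective j
    change Sum.elim (ρπ σ x).1 (ρπ σ x).2 (finSumFinEquiv.symm (finSumFinEquiv s)) = _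
    rw [Equiv.symm_apply_apply, hρπ, Function.comp_apply, Equiv.symm_apply_apply]
    rcases s with i | i
    · simp
    · simp
  rw [← 𝔅.labelledHodgeTateWeights_eq_of_equiv ρπ (FramedRep.toContinuousRep (ρ₁.blockSum ρ₂)) Φ hΦ τ,
    𝔅.labelledHodgeTateWeights_prod ρπ (FramedRep.toContinuousRep ρ₁) (FramedRep.toContinuousRep ρ₂)
      hρπ τ hfin₁ hfin₂]

end BlockSum

end PeriodRingData

end Literature.NumberTheory.GaloisRepresentations

end
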